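import Summits.NavierStokesRegularity.NavierStokesRegularity.Theses.CoreLogGas

/-!
# Re-typing candidates for the crux B `CoreLogGas.BlowupIsLocallyDriven` (stmt-NavierStokesRegularity-11291)
# — evidence file of lead c3 (line `registered` dead), NOT a proposal

Elaboration-checked statements for the planner / crux ideation, written over verbatim sub-terms of the route decl.

* `B_filed` — the crux as filed, through the abbreviations `Admissible` / `defect` (`B_filed_iff : _ ↔ B` is `Iff.rfl`).
* `B_rate p` — the refuters' scale-free modulus (R1/R2, Repair.lean `B_quadratic` is `p = 2` without `g`):
  `∃ C t₀ g, ∀ M ≥ 1, ∀ admissible (t,x,ρ), ∀ unit e, |⟪defect_{Mρ} e, e⟫| ≤ C·M^{-p}·Ω(t) + g(t)`, `g ∈ L¹(t₀,T)`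
  (the `+ g` absorbs the energy-class far field beyond a fixed radius, `Registered.farFieldStrain`). Window from the
  refuters' calibrations: `1 < p ≤ 2` (sheets give `M⁻¹`, rings saturate `M⁻²`, tubes/pairs `M⁻⁴`).
* `B_rate_xi p` — NEW (lead c3): the same with the STRETCHING DIRECTION ONLY, `e = ξ(t,x) = ω(t,x)/|ω(t,x)|`, written
  without division as `|⟪defect_{Mρ} ω(t,x), ω(t,x)⟫| ≤ (C·M^{-p}·Ω(t) + g(t))·|ω(t,x)|²`. Rationale: only
  `⟪S ξ, ξ⟫` amplifies `|ω|` at a maximum point (`∂ₜ|ω| ≤ ⟪Sξ,ξ⟫|ω|` there), and by Constantin's identity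
  `⟪S(x)ξ(x),ξ(x)⟫ = (3/4π) PV∫ (ŷ·ξ(x)) det(ŷ, ω(x+y), ξ(x)) dy/|y|³` (Constantin 1994; Majda–Bertozzi 2002 Prop. 2.17)
  far vorticity PARALLEL or ANTIPARALLEL to `ξ(x)` exerts no stretching at all: for a straight tube of any cross-section
  and for an antiparallel pair the flow is planar, `u_z ≡ 0`, so `⟪defect_{Mρ} ẑ, ẑ⟫ = 0` identically at every point and
  every `M` — the refuters' off-axis tube constant `0.37–0.54/M⁴` and pair constant `3Γd²/(16πM⁴ρ⁴)` are TRANSVERSE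
  (core-deforming) strain, invisible to `B_rate_xi`. Rings (`∼ M⁻² log`), swirling blobs and direction-disordered
  sheets / Hou's radial 'hedgehog' pancake keep a nonzero stretching fraction, so `B_rate_xi` still needs the rate `p`;
  it encodes the Constantin–Fefferman direction-coherence dichotomy rather than a shape trichotomy.
* `A_rate p`, `A_rate_xi p` — the matching re-typings of crux A (`LocallyDrivenIsTypeI`), and the compositions
  `noTypeII_of_rate`, `noTypeII_of_rate_xi`, `closes_of_rate`, `closes_of_rate_xi`: the deciding theorem keeps its
  shape under either re-typing (pure logic, as for the filed pair).
* `B_rate_xi_of_B_rate` — the ξ-variant is weaker than the all-directions variant (so B easier, A harder).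

`lean check`: rc 0, 0 sorries. Scratch namespace; nothing here is proposed to the tree.
-/

noncomputable section

open Set MeasureTheory Filter Topology Metric

-- justification: scratch namespace under the crux's Cruxes/ path (evidence file, not proposed).
set_option linter.dupNamespace false

namespace Summit.NavierStokesRegularity.NavierStokesRegularity.Cruxes.BlowupIsLocallyDriven.RetypingC3

open Literature.Analysis.FluidPDE

/-- Admissible triple `(t, x, ρ)` of the crux: `x` a deep near-maximum vorticity point, `B(x,ρ)` an inscribed
quarter-max ball, `ρ` at least half the largest such radius (verbatim sub-terms of the route decl). -/
def Admissible (u : ℝ → EuclideanSpace ℝ (Fin 3) → EuclideanSpace ℝ (Fin 3)) (t : ℝ)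
    (x : EuclideanSpace ℝ (Fin 3)) (ρ : ℝ) : Prop :=
  0 < ρ ∧
  (⨆ z, ‖Literature.Analysis.FluidPDE.curl (u t) z‖) ≤ 2 * ‖Literature.Analysis.FluidPDE.curl (u t) x‖ ∧
  Metric.ball x ρ ⊆ {y | (⨆ z, ‖Literature.Analysis.FluidPDE.curl (u t) z‖) ≤
    4 * ‖Literature.Analysis.FluidPDE.curl (u t) y‖} ∧
  (∀ (x' : EuclideanSpace ℝ (Fin 3)) (ρ' : ℝ),
    (⨆ z, ‖Literature.Analysis.FluidPDE.curl (u t) z‖) ≤ 2 * ‖Literature.Analysis.FluidPDE.curl (u t) x'‖ →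
    Metric.ball x' ρ' ⊆ {y | (⨆ z, ‖Literature.Analysis.FluidPDE.curl (u t) z‖) ≤
      4 * ‖Literature.Analysis.FluidPDE.curl (u t) y‖} → ρ' ≤ 2 * ρ)

/-- The far-strain defect operator at truncation radius `r`: `∇u(t,x) − ∇BS[1_{B(x,r)} ω(t)](x)` (Biot–Savart written
out exactly as in the route decl). -/
def defect (u : ℝ → EuclideanSpace ℝ (Fin 3) → EuclideanSpace ℝ (Fin 3)) (t : ℝ)
    (x : EuclideanSpace ℝ (Fin 3)) (r : ℝ) : EuclideanSpace ℝ (Fin 3) →L[ℝ] EuclideanSpace ℝ (Fin 3) :=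
  fderiv ℝ (u t) x - fderiv ℝ (fun z : EuclideanSpace ℝ (Fin 3) => ∫ y, (4 * Real.pi * ‖z - y‖ ^ 3)⁻¹ •
    Literature.Analysis.FluidPDE.cross ((Metric.ball x r).indicator (Literature.Analysis.FluidPDE.curl (u t)) y)
      (z - y)) x

/-- The vorticity maximum `Ω(t) = ⨆ |ω(t,·)|` (Real.iSup, as in the route decl). -/
def Omega (u : ℝ → EuclideanSpace ℝ (Fin 3) → EuclideanSpace ℝ (Fin 3)) (t : ℝ) : ℝ :=
  ⨆ z, ‖Literature.Analysis.FluidPDE.curl (u t) z‖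

/-! ### B as filed -/

/-- The crux B as filed, through the abbreviations. -/
def B_filed : Prop :=
  ∀ (ν T : ℝ), 0 < ν → 0 < T →
  ∀ (u : ℝ → EuclideanSpace ℝ (Fin 3) → EuclideanSpace ℝ (Fin 3)) (p : ℝ → EuclideanSpace ℝ (Fin 3) → ℝ),
    IsMaximalSmoothSolution ν 0 u p T → IsLerayHopfOn T ν 0 (u 0) u → HasRapidSpatialDecay (u 0) →
    ∃ (M t₀ : ℝ) (g : ℝ → ℝ), 1 ≤ M ∧ 0 ≤ t₀ ∧ t₀ < T ∧ IntegrableOn g (Ico t₀ T) ∧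
      ∀ t ∈ Ico t₀ T, ∀ (x : EuclideanSpace ℝ (Fin 3)) (ρ : ℝ), 0 < ρ →
        (⨆ z, ‖Literature.Analysis.FluidPDE.curl (u t) z‖) ≤ 2 * ‖Literature.Analysis.FluidPDE.curl (u t) x‖ →
        Metric.ball x ρ ⊆ {y | (⨆ z, ‖Literature.Analysis.FluidPDE.curl (u t) z‖) ≤
          4 * ‖Literature.Analysis.FluidPDE.curl (u t) y‖} →
        (∀ (x' : EuclideanSpace ℝ (Fin 3)) (ρ' : ℝ),
          (⨆ z, ‖Literature.Analysis.FluidPDE.curl (u t) z‖) ≤ 2 * ‖Literature.Analysis.FluidPDE.curl (u t) x'‖ →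
          Metric.ball x' ρ' ⊆ {y | (⨆ z, ‖Literature.Analysis.FluidPDE.curl (u t) z‖) ≤
            4 * ‖Literature.Analysis.FluidPDE.curl (u t) y‖} → ρ' ≤ 2 * ρ) →
        ∀ e : EuclideanSpace ℝ (Fin 3), ‖e‖ = 1 → |inner ℝ (defect u t x (M * ρ) e) e| ≤ g t

/-- `B_filed` is the route decl (definitional). -/
theorem B_filed_iff : B_filed ↔ Theses.CoreLogGas.BlowupIsLocallyDriven := Iff.rfl

/-! ### Scale-free re-typings -/

/-- **`B_rate p`** — scale-free locality modulus with rate `p`, all directions: for every maximal solution there are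
`C ≥ 0`, `t₀ < T` and `g ∈ L¹(t₀,T)` with `|⟪defect_{Mρ} e, e⟫| ≤ C·M^{-p}·Ω(t) + g(t)` for ALL `M ≥ 1`, all
admissible `(t,x,ρ)`, `t ≥ t₀`, and all unit `e`. -/
def B_rate (p : ℝ) : Prop :=
  ∀ (ν T : ℝ), 0 < ν → 0 < T →
  ∀ (u : ℝ → EuclideanSpace ℝ (Fin 3) → EuclideanSpace ℝ (Fin 3)) (q : ℝ → EuclideanSpace ℝ (Fin 3) → ℝ),
    IsMaximalSmoothSolution ν 0 u q T → IsLerayHopfOn T ν 0 (u 0) u → HasRapidSpatialDecay (u 0) →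
    ∃ (C t₀ : ℝ) (g : ℝ → ℝ), 0 ≤ C ∧ 0 ≤ t₀ ∧ t₀ < T ∧ IntegrableOn g (Ico t₀ T) ∧
      ∀ (M : ℝ), 1 ≤ M → ∀ t ∈ Ico t₀ T, ∀ (x : EuclideanSpace ℝ (Fin 3)) (ρ : ℝ), Admissible u t x ρ →
        ∀ e : EuclideanSpace ℝ (Fin 3), ‖e‖ = 1 →
          |inner ℝ (defect u t x (M * ρ) e) e| ≤ C * M ^ (-p) * Omega u t + g t

/-- **`B_rate_xi p`** — the same modulus for the STRETCHING DIRECTION only (`e = ξ(t,x)`, written without division):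
`|⟪defect_{Mρ} ω(t,x), ω(t,x)⟫| ≤ (C·M^{-p}·Ω(t) + g(t)) · |ω(t,x)|²`. Far vorticity parallel / antiparallel to `ξ(t,x)`
contributes nothing to the left-hand side (Constantin's identity), so straight tubes and antiparallel pairs pass with
`C = 0`. -/
def B_rate_xi (p : ℝ) : Prop :=
  ∀ (ν T : ℝ), 0 < ν → 0 < T →
  ∀ (u : ℝ → EuclideanSpace ℝ (Fin 3) → EuclideanSpace ℝ (Fin 3)) (q : ℝ → EuclideanSpace ℝ (Fin 3) → ℝ),
    IsMaximalSmoothSolution ν 0 u q T → IsLerayHopfOn T ν 0 (u 0) u → HasRapidSpatialDecay (u 0) →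
    ∃ (C t₀ : ℝ) (g : ℝ → ℝ), 0 ≤ C ∧ 0 ≤ t₀ ∧ t₀ < T ∧ IntegrableOn g (Ico t₀ T) ∧
      ∀ (M : ℝ), 1 ≤ M → ∀ t ∈ Ico t₀ T, ∀ (x : EuclideanSpace ℝ (Fin 3)) (ρ : ℝ), Admissible u t x ρ →
        |inner ℝ (defect u t x (M * ρ) (Literature.Analysis.FluidPDE.curl (u t) x))
            (Literature.Analysis.FluidPDE.curl (u t) x)| ≤
          (C * M ^ (-p) * Omega u t + g t) * ‖Literature.Analysis.FluidPDE.curl (u t) x‖ ^ 2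

/-- **`A_rate p`** — crux A re-typed with the hypothesis of `B_rate p`. -/
def A_rate (p : ℝ) : Prop :=
  ∀ (ν T : ℝ), 0 < ν → 0 < T →
  ∀ (u : ℝ → EuclideanSpace ℝ (Fin 3) → EuclideanSpace ℝ (Fin 3)) (q : ℝ → EuclideanSpace ℝ (Fin 3) → ℝ),
    IsMaximalSmoothSolution ν 0 u q T → IsLerayHopfOn T ν 0 (u 0) u → HasRapidSpatialDecay (u 0) →
    (∃ (C t₀ : ℝ) (g : ℝ → ℝ), 0 ≤ C ∧ 0 ≤ t₀ ∧ t₀ < T ∧ IntegrableOn g (Ico t₀ T) ∧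
      ∀ (M : ℝ), 1 ≤ M → ∀ t ∈ Ico t₀ T, ∀ (x : EuclideanSpace ℝ (Fin 3)) (ρ : ℝ), Admissible u t x ρ →
        ∀ e : EuclideanSpace ℝ (Fin 3), ‖e‖ = 1 →
          |inner ℝ (defect u t x (M * ρ) e) e| ≤ C * M ^ (-p) * Omega u t + g t) →
    IsTypeIBlowup u T

/-- **`A_rate_xi p`** — crux A re-typed with the hypothesis of `B_rate_xi p`. -/
def A_rate_xi (p : ℝ) : Prop :=
  ∀ (ν T : ℝ), 0 < ν → 0 < T →
  ∀ (u : ℝ → EuclideanSpace ℝ (Fin 3) → EuclideanSpace ℝ (Fin 3)) (q : ℝ → EuclideanSpace ℝ (Fin 3) → ℝ),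
    IsMaximalSmoothSolution ν 0 u q T → IsLerayHopfOn T ν 0 (u 0) u → HasRapidSpatialDecay (u 0) →
    (∃ (C t₀ : ℝ) (g : ℝ → ℝ), 0 ≤ C ∧ 0 ≤ t₀ ∧ t₀ < T ∧ IntegrableOn g (Ico t₀ T) ∧
      ∀ (M : ℝ), 1 ≤ M → ∀ t ∈ Ico t₀ T, ∀ (x : EuclideanSpace ℝ (Fin 3)) (ρ : ℝ), Admissible u t x ρ →
        |inner ℝ (defect u t x (M * ρ) (Literature.Analysis.FluidPDE.curl (u t) x))
            (Literature.Analysis.FluidPDE.curl (u t) x)| ≤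
          (C * M ^ (-p) * Omega u t + g t) * ‖Literature.Analysis.FluidPDE.curl (u t) x‖ ^ 2) →
    IsTypeIBlowup u T

/-! ### Relations and compositions -/

/-- Quadratic-form scaling: `⟪D (c • e), c • e⟫ = c² ⟪D e, e⟫`. -/
theorem inner_apply_smul_self (D : EuclideanSpace ℝ (Fin 3) →L[ℝ] EuclideanSpace ℝ (Fin 3))
    (c : ℝ) (e : EuclideanSpace ℝ (Fin 3)) :
    inner ℝ (D (c • e)) (c • e) = c ^ 2 * inner ℝ (D e) e := by
  rw [map_smul, inner_smul_left, inner_smul_right]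
  simp only [conj_trivial]
  ring

/-- The all-directions modulus implies the stretching-direction modulus (take `e = ω(t,x)/|ω(t,x)|`). -/
theorem B_rate_xi_of_B_rate (p : ℝ) (h : B_rate p) : B_rate_xi p := by
  intro ν T hν hT u q hmax hlh hdec
  obtain ⟨C, t₀, g, hC, ht₀, ht₀T, hg, hH⟩ := h ν T hν hT u q hmax hlh hdec
  refine ⟨C, t₀, g, hC, ht₀, ht₀T, hg, fun M hM t ht x ρ hadm => ?_⟩
  set w := Literature.Analysis.FluidPDE.curl (u t) x with hw
  by_cases hw0 : w = 0
  · simp [hw0]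
  · have hnw : 0 < ‖w‖ := norm_pos_iff.2 hw0
    set e := ‖w‖⁻¹ • w with he
    have hen : ‖e‖ = 1 := by
      rw [he, norm_smul, norm_inv, norm_norm, inv_mul_cancel₀ hnw.ne']
    have hwe : w = ‖w‖ • e := by
      rw [he, smul_smul, mul_inv_cancel₀ hnw.ne', one_smul]
    have hb := hH M hM t ht x ρ hadm e hen
    calc |inner ℝ (defect u t x (M * ρ) w) w|
        = |inner ℝ (defect u t x (M * ρ) (‖w‖ • e)) (‖w‖ • e)| := by rw [← hwe]
      _ = ‖w‖ ^ 2 * |inner ℝ (defect u t x (M * ρ) e) e| := by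
          rw [inner_apply_smul_self, abs_mul, abs_of_nonneg (sq_nonneg _)]
      _ ≤ ‖w‖ ^ 2 * (C * M ^ (-p) * Omega u t + g t) := mul_le_mul_of_nonneg_left hb (sq_nonneg _)
      _ = (C * M ^ (-p) * Omega u t + g t) * ‖w‖ ^ 2 := mul_comm _ _

/-- `A_rate p ∧ B_rate p → NoTypeII` (the route's target; pure logic). -/
theorem noTypeII_of_rate (p : ℝ) (hA : A_rate p) (hB : B_rate p) : Theses.CoreLogGas.NoTypeII :=
  fun ν T hν hT u q hmax hlh hdec => hA ν T hν hT u q hmax hlh hdec (hB ν T hν hT u q hmax hlh hdec)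

/-- `A_rate_xi p ∧ B_rate_xi p → NoTypeII` (pure logic). -/
theorem noTypeII_of_rate_xi (p : ℝ) (hA : A_rate_xi p) (hB : B_rate_xi p) : Theses.CoreLogGas.NoTypeII :=
  fun ν T hν hT u q hmax hlh hdec => hA ν T hν hT u q hmax hlh hdec (hB ν T hν hT u q hmax hlh hdec)

/-- The deciding theorem keeps its shape under the re-typing `(A_rate p, B_rate p)`. -/
theorem closes_of_rate (p : ℝ) (hA : A_rate p) (hB : B_rate p) (hI : Theses.CoreLogGas.NoTypeIBlowup)
    (hC : Theses.CoreLogGas.NoBlowupToClay) : _root_.NavierStokesRegularity := by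
  refine hC ?_
  intro ν T hν hT u q hcl hlh hdec
  by_contra hne
  have hmax : Literature.Analysis.FluidPDE.IsMaximalSmoothSolution ν 0 u q T := ⟨hcl, hne⟩
  exact hne (hI ν T hν hT u q hcl hlh hdec (noTypeII_of_rate p hA hB ν T hν hT u q hmax hlh hdec))

/-- The deciding theorem keeps its shape under the re-typing `(A_rate_xi p, B_rate_xi p)`. -/
theorem closes_of_rate_xi (p : ℝ) (hA : A_rate_xi p) (hB : B_rate_xi p) (hI : Theses.CoreLogGas.NoTypeIBlowup)
    (hC : Theses.CoreLogGas.NoBlowupToClay) : _root_.NavierStokesRegularity := by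
  refine hC ?_
  intro ν T hν hT u q hcl hlh hdec
  by_contra hne
  have hmax : Literature.Analysis.FluidPDE.IsMaximalSmoothSolution ν 0 u q T := ⟨hcl, hne⟩
  exact hne (hI ν T hν hT u q hcl hlh hdec (noTypeII_of_rate_xi p hA hB ν T hν hT u q hmax hlh hdec))

end Summit.NavierStokesRegularity.NavierStokesRegularity.Cruxes.BlowupIsLocallyDriven.RetypingC3

end
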